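import Literature.MathematicalPhysics.QuantumFieldTheory.Balaban1983to89.Node00.N24GlueStage12C
import Literature.MathematicalPhysics.QuantumFieldTheory.Balaban1983to89.Node00.Record12CarriersRecords

/-!
# NODE N24 · (B2) AT THE STAGE-12 CARRIER CHAINS OF NODE 00 (node00-def lineage's `Node00/Record12Carriers` + `Node00/Record12CarriersRecords`, the Stage-12 re-instantiation of the ₁₁ chain): the four-pin record `IsRecordOfRecord₁₂CB10YZW → ₁₂C`
# (SAME datum, SAME world — [B10] ∕ [B9] ∕ [B11] ∕ [IV] groups pinned) and the five-pin record `IsRecordOfRecord₁₂CB10YZWB8` ([B8] pinned, `b8` IN ITS SURVIVING FORM,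
# S-binding — SAME-DATUM companion only): module 17's recipe at Stage 12 — the pinned children at their statements of record, every other child at θ₁₂ by name

TRACK A (YM-PLAN §2d, node N24 of 28 = binder B2 `hB : B16.EndStatementBPrinted D.C`), seat `pub-ymgap-dag-n24-c` (R134 fan-out seat, strategy s2; FAN-OUT v1.1 §N24 s2).
TWENTY-SIXTH N24 module, a NEW importing one (modules 1–24 untouched; = module 21 `Node00/N24KnitStage11Carriers` re-keyed ₁₁ ↦ ₁₂ BY NAME; sequel of module 23
`Node00/N24GlueStage12C`).  THEOREMS ONLY, def-free, sorry-free, standard axioms.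

WHY.  Node 00's carrier pins at Stage 12 come as two record predicates (node00-def lineage, `Node00/Record12Carriers` ∕ `Node00/Record12CarriersRecords` over def-T's REPAIRED `Record12` v2.2):
* `IsRecordOfRecord₁₂CB10YZW F N D w` — def-T's `IsRecordOfRecord₁₂C` VERBATIM with the upstream block the C-binding at the FOUR-PIN view `θ.view₁₂B10YZW Mstar ops ζ lamW`
  ([B10] runs, the [B9] group at def-Y's `Y9OfRecord` over a residual operator layer `ops`, the [B11] group at `Z11OfRecord ζ`, the [IV] group at `WOfRecord₁₂ θ lamW`); it
  REFINES `₁₂C` WITH THE SAME `(D, w)` (`isRecordOfRecord₁₂C_of_isRecordOfRecord₁₂CB10YZW`), so module 20 transfers in one line and the pinned children N06 ∕ N07 ∕ N08 ∕ N12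
  are read at their statements of record through node00-def's faces `b10_main_iff_of_…` ∕ `b9_b11_b15_main_of_…_of_slots` (§1);
* `IsRecordOfRecord₁₂CB10YZWB8 F N D w` — the same with the [B8] group pinned to n05-a's family of record and the upstream block THE S-BINDING `upOfRecord₅CS` at the
  five-pin view (`b8` = the SURVIVING leaf `B8LeafOfRecord θ.toStage3Params lam`, because the leaf AS TYPED is kernel-refuted on print's admitted flat members — `CarriersB8`
  header).  This record is NOT a `₁₂C` record at the same world (S- vs C-binding); what it has is a SAME-DATUM COMPANION in `₁₂CB10YZW` at the world re-bound by the
  C-binding (`companion_of_isRecordOfRecord₁₂CB10YZWB8`: leaves agree off `b8`; companion `b8` ⇒ record `b8`, never conversely).  (B2) `B16.EndStatementBPrinted D.C` READS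
  THE DATUM ONLY, and of the thirteen DAG sentences `Dag.Bk_main` only B10 ∕ B11 ∕ B12 ∕ B14 ∕ B15 have `b8` as an in-edge (`Dag.lean`): so the engine at the S-bound world is
  DagBinding's headline `endStatementBPrinted_of_nodesP_interval_guarded` AT `w` ITSELF, with N01–N04 and the guarded (0.20) carried over from the companion (they never read
  `b8` — node00-def's `b4_b5_b6_b7_of_…`), N05 from the DISPLAYED slot `B8LeafOfRecord θ₃ lam` (node00-def's `b8_main_of_…_of_slots`; ref-C's read rule (B8-2)∕(B8-3): no `atWorld`
  transfer at a `b8`-reading sentence, `B8LeafOfRecord` never obtained from the record), N06 N07 N08 N12 from the five pinned leaves (their DAG sentences discard the in-edges),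
  N10 and N13 — whose sentences read no `b8` — through the C-bound twin world by `rfl` transport, N09 and N11 by-name binders AT `w` (§2).

WHAT THIS FILE PROVES.
§1 AT `IsRecordOfRecord₁₂CB10YZW`: `N24_at_record₁₂CB10YZW_knit_pinned` (module 20's `N24_at_record₁₂C_knit_pinned`, one-line transfer), `N24_b10_main_of_isRecordOfRecord₁₂CB10YZW_of_printedUV3V`
   (N08 ← `PrintedUV3V N L` at the world's odd block size `L > 1`), **`N24_at_record₁₂CB10YZW_knit_all_carriers_pinned`** (module 17's recipe at Stage 12: N08 the printed slot;
   N06 ∧ N07 ∧ N12 ← «for every presenting `(θ, h, M⋆, ops, ζ, λW)`: def-Y's leaf `B9LeafX (Y9OfRecord N θ₃ M⋆ ops)` ∧ `B11Leaf (Z11OfRecord F N ζ)` ∧ `∀ P, B15Leaf (WOfRecord₁₂ θ λW P)`»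
   — HIDDEN residual layers, junk-closable, hence location-positive ∕ strength-neutral, not bookable in ∀-form; the X-[B8] and B13 θ-keyed sockets of module 20; N09 ∕ N11 binders;
   N13 world-level `hR` + `hcor3`; β-box), `N24_at_record₁₂CB10YZW_knit_all_carriers_of_betaMerged_pinned` (β read at the merged β over `mergedTermFamilyMatT (TcOfRecord) (chiFixed7 θ.ν)`).
§2 AT `IsRecordOfRecord₁₂CB10YZWB8`: `N24_isRecordOfRecord₁₂CB10YZWB8_withExp` (re-lettering the exponents keeps the record), `N24_nodes₀₁₀₂₀₃₀₄_of_isRecordOfRecord₁₂CB10YZWB8`,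
   `N24_rgFlow_of_smallCouplings_of_isRecordOfRecord₁₂CB10YZWB8` (guarded (0.20) at the S-bound world), **`N24_at_record₁₂CB10YZWB8`** (THE ENGINE AT THE S-BOUND WORLD: nine
   by-name binders N05 … N13 + β-box ⇒ (B2)), `N24_at_record₁₂CB10YZWB8_of_N13_exists`, `N24_b9_b11_b15_b10_main_of_isRecordOfRecord₁₂CB10YZWB8_of_slots` (N06 N07 N12 N08 from
   the five-pin leaves), `N24_b13_main_of_isRecordOfRecord₁₂CB10YZWB8_of_slot` (N10 from the B13 socket over the five-pin view, via the C-bound twin), `N24_b16_main_withExp_of_isRecordOfRecord₁₂CB10YZWB8`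
   (N13 world-level via the twin's shadow), **`N24_at_record₁₂CB10YZWB8_knit_all_carriers_pinned`** (WHICH CHILD BLOCKS at the five-pin record, kernel form: N05 the surviving-leaf slot
   `B8LeafOfRecord θ₃ λ`; N06 ∧ N07 ∧ N12 the hidden layers' leaves; N08 one printed ∃-slot; N10 the B13 socket; N09 ×1, N11 ×1 binders; N13 𝐑-leaf + Cor.-3 leaves; β ×2),
   `N24_at_record₁₂CB10YZWB8_knit_all_carriers_of_betaMerged_pinned`.

VACUITY ∕ A1 (LINE №45 (3), RIDER №7; ref-C (B8-4)).  Both chains are inhabited iff `₁₂C` is (`exists_world_isRecordOfRecord₁₂CB10YZW[B8]`) = item K0 `Record11Inhabited`, OWED;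
every theorem below is a per-record implication; a ∀-form over either chain is NOT-A-DISCHARGE; the hidden-layer hypotheses (`ops`, `ζ`, `λW`, `λ`) are junk-closable.
HONEST FRAMING: kernel bookkeeping BY NAME; nothing of Bałaban's asserted; every slot DISPLAYED; N24 COMPOSITE — no discharge, no count; one finite T⁴ programme at fixed ε;
NOT continuum ∕ ℝ⁴ ∕ OS ∕ mass gap ∕ Clay.
-/

noncomputable section

open scoped Matrix.Norms.L2Operator

namespace Literature.MathematicalPhysics.QuantumFieldTheory.Balaban1983to89.Node00

open DagBinding T4Continuum T4DatumAssembly FlowStepRuns AveragingRT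
open FlowStep (box_mono)

variable {F : T4Family} {N : ℕ} [NeZero N] {D : FiniteEpsData F (SU N)} {w : WorldP}

/-! ## §1. At the four-pin Stage-12 record `IsRecordOfRecord₁₂CB10YZW` (same datum, same world as `₁₂C`) -/

/-- **The one-line transfer**: module 20's `N24_at_record₁₂C_knit_pinned` at a record of the four-pin Stage-12 predicate, through
`isRecordOfRecord₁₂C_of_isRecordOfRecord₁₂CB10YZW` (same `(D, w)`; the θ-keyed sockets quantify over every ₁₂C presentation, the pinned one included).
[cite: Balaban1989LargeFieldII, Thm 1 p.355 + pp.387, 391; Balaban1985UV3, Thm 1 p.257 + Thm 2 p.272; Balaban1985BackgroundPropagators, Thms 3.1–3.15 pp.397–432; Balaban1985Variational, Thm 1 p.279; Balaban1989LargeFieldI, Prop. 1 p.194 (bookkeeping over the carrier-pinned Stage-12 record)] -/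
theorem N24_at_record₁₂CB10YZW_knit_pinned (h : IsRecordOfRecord₁₂CB10YZW F N D w) {γ₀ : ℝ} (hγ₀ : w.γ ≤ γ₀)
    (slots₀₅ : ∀ (θ : Stage12Params F N) (hP : θ.Provisos₁₂ F N), θ.Admissible F N → D = datumOfRecord₁₂ F N θ hP →
      (∀ P, w.up P = upOfRecord₅C F N (θ.toStage5₁₂ F N) P) → ∀ P : B12.RunParams,
        B8LeafR (θ.res.X P).d8 (θ.res.X P).L8 (θ.res.X P).C₂ (θ.res.X P).B₁' (θ.res.X P).B₀' (θ.res.X P).B₁ (θ.res.X P).B₂ (θ.res.X P).c₁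
          (θ.res.X P).inp8 (θ.res.X P).B₀β (θ.res.X P).loc8 (θ.res.X P).fam8R (θ.res.X P).lan8 (θ.res.X P).cub8 (θ.res.X P).toAxial8)
    (slots₀₆ : ∀ (θ : Stage12Params F N) (hP : θ.Provisos₁₂ F N), θ.Admissible F N → D = datumOfRecord₁₂ F N θ hP →
      (∀ P, w.up P = upOfRecord₅C F N (θ.toStage5₁₂ F N) P) → ∀ P : B12.RunParams, B9LeafX (θ.res.Y P))
    (slots₀₇ : ∀ (θ : Stage12Params F N) (hP : θ.Provisos₁₂ F N), θ.Admissible F N → D = datumOfRecord₁₂ F N θ hP →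
      (∀ P, w.up P = upOfRecord₅C F N (θ.toStage5₁₂ F N) P) → ∀ P : B12.RunParams, B11Leaf (θ.res.Z P))
    (slots₀₈ : ∀ (θ : Stage12Params F N) (hP : θ.Provisos₁₂ F N), θ.Admissible F N → D = datumOfRecord₁₂ F N θ hP →
      (∀ P, w.up P = upOfRecord₅C F N (θ.toStage5₁₂ F N) P) → ∀ P : B12.RunParams,
        ∃ (Xc : PrintedCarriersR) (I : Type) (C : B10Assembly.Consts) (T : I → B10.TowerRun),
          Nonempty (∀ i, B10Assembly.LeafSystem C (T i)) ∧ θ.res.X P = Xc.withTowerRuns10 T)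
    (h09 : ∀ P : B12.RunParams, Dag.B12_main (leavesP w P))
    (slots₁₀ : ∀ (θ : Stage12Params F N) (hP : θ.Provisos₁₂ F N), θ.Admissible F N → D = datumOfRecord₁₂ F N θ hP →
      (∀ P, w.up P = upOfRecord₅C F N (θ.toStage5₁₂ F N) P) → ∀ P : B12.RunParams,
        B9LeafX (θ.res.Y P) →
          (B10.Thm1PrintedCompact (θ.res.X P).runs10 ∧ B10.Thm2Printed (θ.res.X P).runs10) →
            B11Leaf (θ.res.Z P) → B12Sec2to5.Lemma4Printed (θ.res.X P).F12 (θ.res.X P).c12 →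
              B13.Lemma1Printed (θ.res.X P).S13 (θ.res.X P).c13 ∧ B13.Lemma2Printed (θ.res.X P).S13 (θ.res.X P).c13 ∧
                B13.Lemma3Printed (θ.res.X P).S13 (θ.res.X P).c13)
    (h11 : ∀ P : B12.RunParams, Dag.B14_main (leavesP w P))
    (slots₁₂ : ∀ (θ : Stage12Params F N) (hP : θ.Provisos₁₂ F N), θ.Admissible F N → D = datumOfRecord₁₂ F N θ hP →
      (∀ P, w.up P = upOfRecord₅C F N (θ.toStage5₁₂ F N) P) → ∀ P : B12.RunParams, B15Leaf (θ.res.W P))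
    (hR : ∀ P : B12.RunParams, (w.up P).rOperation)
    (hcor3 : ∃ (em ep : ℝ → ℝ) (R : B14Cor3.ReprFamily D.C),
      B14Cor3.LeafH D.C R w.γ ∧ B14Cor3.LeafU1 D.C R w.γ ∧ B14Cor3.LeafU2 D.C R w.γ ep ∧ B14Cor3.LeafL1 D.C R w.γ ∧ B14Cor3.LeafL2 D.C R w.γ em)
    (hlo : FlowStep.BetaLowerH w.b γ₀ D.βfun) (hhi : FlowStep.BetaUpperH w.βup γ₀ D.βfun) :
    B16.EndStatementBPrinted D.C :=
  N24_at_record₁₂C_knit_pinned (isRecordOfRecord₁₂C_of_isRecordOfRecord₁₂CB10YZW h) hγ₀ slots₀₅ slots₀₆ slots₀₇ slots₀₈ h09 slots₁₀ h11 slots₁₂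
    hR hcor3 hlo hhi

/-- **N08 · [Balaban1985UV3] at every run of a `₁₂CB10YZW` record FROM THE PRINTED SLOT AT THE WORLD'S BLOCK SIZE** (node00-def's `b10_main_iff_of_isRecordOfRecord₁₂CB10YZW`;
module 17's `N24_b10_main_of_isRecordOfRecord₉CB10Y_of_printedUV3V` at Stage 12). [cite: Balaban1985UV3, (1)–(5) p.256, Thm 1 p.257 (compact reading) + Thm 2 p.272] -/
theorem N24_b10_main_of_isRecordOfRecord₁₂CB10YZW_of_printedUV3V (h : IsRecordOfRecord₁₂CB10YZW F N D w)
    (hUV₀₈ : ∀ L : ℕ, Odd L → 1 < L → w.L = (L : ℝ) → PrintedUV3V N L) (P : B12.RunParams) : Dag.B10_main (leavesP w P) := by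
  obtain ⟨L, hL, hwL, hiff⟩ := b10_main_iff_of_isRecordOfRecord₁₂CB10YZW h
  exact (hiff P).2 fun _ _ _ _ _ _ => hUV₀₈ L hL.1 hL.2 hwL

/-- **N24 · (B2) AT THE FOUR-PIN STAGE-12 RECORD, THE PINNED CHILDREN AT THEIR STATEMENTS OF RECORD, EVERY OTHER CHILD AT θ₁₂ BY NAME** (module 17's recipe at Stage 12
over node00-def's `Record12Carriers`): **N08** ← the printed slot `PrintedUV3V N L` at the world's odd block size `L > 1`; **N06 ∧ N07 ∧ N12** ← «for every `(θ, h, M⋆, ops, ζ, λW)`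
presenting the record: def-Y's leaf `B9LeafX (Y9OfRecord N θ.toStage3Params M⋆ ops)` ∧ the [B11] leaf `B11Leaf (Z11OfRecord F N ζ)` ∧ the [IV] leaf `∀ P, B15Leaf (WOfRecord₁₂ θ λW P)`»
(`b9_b11_b15_main_of_isRecordOfRecord₁₂CB10YZW_of_slots`; HONEST: all three quantify over HIDDEN residual layers and are junk-closable — def-Y's `B9PinCarriersNonVacuity.exists_ops_b9LeafX`,
g30's `CarriersZ.exists_residZ_not_b11Leaf` — so none is bookable in ∀-form here; the re-key is LOCATION-positive, STRENGTH-neutral); N05 N10 θ-keyed sockets on X-[B8] ∕ X-B13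
over `θ.toStage5₁₂` (module 20 §0); **N09, N11** by-name binders (their Stage-12 faces pending); **N13** world-level — the record's 𝐑-leaf `hR` (= «𝐓-image form ⇒ §2 form one
level up», format PINNED at ₁₂) + the Cor.-3 leaves `hcor3`; β-box on `D.βfun`.  WHICH CHILD BLOCKS at `₁₂CB10YZW`, kernel form: N08 one printed ∃-slot; N06 ∧ N07 ∧ N12 the
hidden layers' leaves; two residual sockets (X-[B8], X-B13); N09 ×1; N11 ×1; N13 𝐑-leaf + Cor.-3; β ×2; K0 at ₁₂.
[cite: Balaban1989LargeFieldII, Thm 1 p.355, (0.1) pp.355–356, p.387, p.391; Balaban1985UV3, (1)–(5) p.256, Thm 1 p.257 + Thm 2 p.272; Balaban1985BackgroundPropagators, Thms 3.1–3.15 pp.397–432; Balaban1985Variational, Thm 1 p.279, Props 2–9 pp.281–309; Balaban1988Convergent, Thm 1 p.262, Thm 2 p.263, p.244, Cor. 3 (2.50) p.264; Balaban1987RG1, Thm 3 p.264, (1.22) p.264; Balaban1985RegularSpaces, Thms 2, 4, 8 pp.83–101; Balaban1988RG2Cluster, Lemmas 1–3 pp.9, 11, 20; Balaban1989LargeFieldI,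 Prop. 1 p.194 (bookkeeping over the carrier-pinned Stage-12 record)] -/
theorem N24_at_record₁₂CB10YZW_knit_all_carriers_pinned (h : IsRecordOfRecord₁₂CB10YZW F N D w) {γ₀ : ℝ} (hγ₀ : w.γ ≤ γ₀)
    (slots₀₅ : ∀ (θ : Stage12Params F N) (hP : θ.Provisos₁₂ F N), θ.Admissible F N → D = datumOfRecord₁₂ F N θ hP →
      (∀ P, w.up P = upOfRecord₅C F N (θ.toStage5₁₂ F N) P) → ∀ P : B12.RunParams,
        B8LeafR (θ.res.X P).d8 (θ.res.X P).L8 (θ.res.X P).C₂ (θ.res.X P).B₁' (θ.res.X P).B₀' (θ.res.X P).B₁ (θ.res.X P).B₂ (θ.res.X P).c₁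
          (θ.res.X P).inp8 (θ.res.X P).B₀β (θ.res.X P).loc8 (θ.res.X P).fam8R (θ.res.X P).lan8 (θ.res.X P).cub8 (θ.res.X P).toAxial8)
    (hYZW : ∀ (θ : Stage12Params F N) (hP : θ.Provisos₁₂ F N) (Mstar : ℕ) (ops : OpsY N θ.toStage3Params Mstar) (ζ : ResidZ F N) (lamW : ResidW F N),
      θ.Admissible F N → D = datumOfRecord₁₂ F N θ hP → (∀ P, w.up P = upOfRecord₅C F N (θ.view₁₂B10YZW F N Mstar ops ζ lamW) P) →
        B9LeafX (Y9OfRecord N θ.toStage3Params Mstar ops) ∧ B11Leaf (Z11OfRecord F N ζ) ∧ ∀ P : B12.RunParams, B15Leaf (WOfRecord₁₂ F N θ lamW P))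
    (hUV₀₈ : ∀ L : ℕ, Odd L → 1 < L → w.L = (L : ℝ) → PrintedUV3V N L)
    (h09 : ∀ P : B12.RunParams, Dag.B12_main (leavesP w P))
    (slots₁₀ : ∀ (θ : Stage12Params F N) (hP : θ.Provisos₁₂ F N), θ.Admissible F N → D = datumOfRecord₁₂ F N θ hP →
      (∀ P, w.up P = upOfRecord₅C F N (θ.toStage5₁₂ F N) P) → ∀ P : B12.RunParams,
        B9LeafX (θ.res.Y P) →
          (B10.Thm1PrintedCompact (θ.res.X P).runs10 ∧ B10.Thm2Printed (θ.res.X P).runs10) →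
            B11Leaf (θ.res.Z P) → B12Sec2to5.Lemma4Printed (θ.res.X P).F12 (θ.res.X P).c12 →
              B13.Lemma1Printed (θ.res.X P).S13 (θ.res.X P).c13 ∧ B13.Lemma2Printed (θ.res.X P).S13 (θ.res.X P).c13 ∧
                B13.Lemma3Printed (θ.res.X P).S13 (θ.res.X P).c13)
    (h11 : ∀ P : B12.RunParams, Dag.B14_main (leavesP w P))
    (hR : ∀ P : B12.RunParams, (w.up P).rOperation)
    (hcor3 : ∃ (em ep : ℝ → ℝ) (R : B14Cor3.ReprFamily D.C),
      B14Cor3.LeafH D.C R w.γ ∧ B14Cor3.LeafU1 D.C R w.γ ∧ B14Cor3.LeafU2 D.C R w.γ ep ∧ B14Cor3.LeafL1 D.C R w.γ ∧ B14Cor3.LeafL2 D.C R w.γ em)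
    (hlo : FlowStep.BetaLowerH w.b γ₀ D.βfun) (hhi : FlowStep.BetaUpperH w.βup γ₀ D.βfun) :
    B16.EndStatementBPrinted D.C :=
  have h₁₂ := isRecordOfRecord₁₂C_of_isRecordOfRecord₁₂CB10YZW h
  have h3 := b9_b11_b15_main_of_isRecordOfRecord₁₂CB10YZW_of_slots h hYZW
  N24_at_record₁₂C_of_N13_leaf h₁₂ hγ₀ (N24_b8_main_of_isRecordOfRecord₁₂C_of_slot h₁₂ slots₀₅) (fun P => (h3 P).1) (fun P => (h3 P).2.1)
    (N24_b10_main_of_isRecordOfRecord₁₂CB10YZW_of_printedUV3V h hUV₀₈) h09 (N24_b13_main_of_isRecordOfRecord₁₂C_of_slot h₁₂ slots₁₀) h11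
    (fun P => (h3 P).2.2) hR hcor3 hlo hhi

/-- **The same with the β-binders READ AT THE MERGED β over `mergedTermFamilyMatT (TcOfRecord) (chiFixed7 θ.ν)` along the world's own box `]0, w.γ]^{k+1}`** (module 20's
`N24_betaLowerH_iff_merged₁₂` ∕ `N24_betaUpperH_iff_merged₁₂` at any ₁₂C presentation of the record).  WHICH CHILD BLOCKS at `₁₂CB10YZW` in the β-version currency (RIDER №6;
lower `b > 0` UNPRINTED, T09.F = NODE O — the β-side definer's binder over ₁₂C; upper β⁺ [Balaban1987RG1] p. 264).
[cite: Balaban1989LargeFieldII, Thm 1 p.355, (0.1) pp.355–356, p.391; Balaban1987RG1, (0.19) p.255, (1.20)–(1.22) p.264, (2.12)–(2.14) p.268; Balaban1985UV3, Thm 1 p.257 + Thm 2 p.272; Balaban1985BackgroundPropagators, Thms 3.1–3.15 pp.397–432; Balaban1985Variational, Thm 1 p.279; Balaban1989LargeFieldI, Prop. 1 p.194 (bookkeeping)] -/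
theorem N24_at_record₁₂CB10YZW_knit_all_carriers_of_betaMerged_pinned (h : IsRecordOfRecord₁₂CB10YZW F N D w)
    (slots₀₅ : ∀ (θ : Stage12Params F N) (hP : θ.Provisos₁₂ F N), θ.Admissible F N → D = datumOfRecord₁₂ F N θ hP →
      (∀ P, w.up P = upOfRecord₅C F N (θ.toStage5₁₂ F N) P) → ∀ P : B12.RunParams,
        B8LeafR (θ.res.X P).d8 (θ.res.X P).L8 (θ.res.X P).C₂ (θ.res.X P).B₁' (θ.res.X P).B₀' (θ.res.X P).B₁ (θ.res.X P).B₂ (θ.res.X P).c₁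
          (θ.res.X P).inp8 (θ.res.X P).B₀β (θ.res.X P).loc8 (θ.res.X P).fam8R (θ.res.X P).lan8 (θ.res.X P).cub8 (θ.res.X P).toAxial8)
    (hYZW : ∀ (θ : Stage12Params F N) (hP : θ.Provisos₁₂ F N) (Mstar : ℕ) (ops : OpsY N θ.toStage3Params Mstar) (ζ : ResidZ F N) (lamW : ResidW F N),
      θ.Admissible F N → D = datumOfRecord₁₂ F N θ hP → (∀ P, w.up P = upOfRecord₅C F N (θ.view₁₂B10YZW F N Mstar ops ζ lamW) P) →
        B9LeafX (Y9OfRecord N θ.toStage3Params Mstar ops) ∧ B11Leaf (Z11OfRecord F N ζ) ∧ ∀ P : B12.RunParams, B15Leaf (WOfRecord₁₂ F N θ lamW P))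
    (hUV₀₈ : ∀ L : ℕ, Odd L → 1 < L → w.L = (L : ℝ) → PrintedUV3V N L)
    (h09 : ∀ P : B12.RunParams, Dag.B12_main (leavesP w P))
    (slots₁₀ : ∀ (θ : Stage12Params F N) (hP : θ.Provisos₁₂ F N), θ.Admissible F N → D = datumOfRecord₁₂ F N θ hP →
      (∀ P, w.up P = upOfRecord₅C F N (θ.toStage5₁₂ F N) P) → ∀ P : B12.RunParams,
        B9LeafX (θ.res.Y P) →
          (B10.Thm1PrintedCompact (θ.res.X P).runs10 ∧ B10.Thm2Printed (θ.res.X P).runs10) →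
            B11Leaf (θ.res.Z P) → B12Sec2to5.Lemma4Printed (θ.res.X P).F12 (θ.res.X P).c12 →
              B13.Lemma1Printed (θ.res.X P).S13 (θ.res.X P).c13 ∧ B13.Lemma2Printed (θ.res.X P).S13 (θ.res.X P).c13 ∧
                B13.Lemma3Printed (θ.res.X P).S13 (θ.res.X P).c13)
    (h11 : ∀ P : B12.RunParams, Dag.B14_main (leavesP w P))
    (hR : ∀ P : B12.RunParams, (w.up P).rOperation)
    (hcor3 : ∃ (em ep : ℝ → ℝ) (R : B14Cor3.ReprFamily D.C),
      B14Cor3.LeafH D.C R w.γ ∧ B14Cor3.LeafU1 D.C R w.γ ∧ B14Cor3.LeafU2 D.C R w.γ ep ∧ B14Cor3.LeafL1 D.C R w.γ ∧ B14Cor3.LeafL2 D.C R w.γ em)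
    (hβm : ∀ (θ : Stage12Params F N) (hP : θ.Provisos₁₂ F N), θ.Admissible F N → D = datumOfRecord₁₂ F N θ hP → w.γ ≤ θ.γ →
      letI := θ.instVβ₁; letI := θ.instVβ₂; letI := θ.instιβ
      FlowStep.BetaLowerH w.b w.γ (betaMerged F (mergedTermFamilyMatT F N (TcOfRecord F N) (chiFixed7 F N θ.ν) θ.εbg) θ.ρ8 θ.bV) ∧
        FlowStep.BetaUpperH w.βup w.γ (betaMerged F (mergedTermFamilyMatT F N (TcOfRecord F N) (chiFixed7 F N θ.ν) θ.εbg) θ.ρ8 θ.bV)) :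
    B16.EndStatementBPrinted D.C := by
  obtain ⟨θ, hP, hθ, hD, -, hγ, -, -⟩ := isRecordOfRecord₁₂C_of_isRecordOfRecord₁₂CB10YZW h
  obtain ⟨hlo, hhi⟩ := hβm θ hP hθ hD hγ.2
  exact N24_at_record₁₂CB10YZW_knit_all_carriers_pinned h le_rfl slots₀₅ hYZW hUV₀₈ h09 slots₁₀ h11 hR hcor3
    ((N24_betaLowerH_iff_merged₁₂ θ hP hD hγ.2).mpr hlo) ((N24_betaUpperH_iff_merged₁₂ θ hP hD hγ.2).mpr hhi)

/-! ## §2. At the five-pin Stage-12 record `IsRecordOfRecord₁₂CB10YZWB8` ([B8] pinned, `b8` surviving, S-binding; same-DATUM companion only) -/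

/-- Re-lettering the EXPONENT letters `(e₋, e₊)` of the world keeps a five-pin Stage-12 record (only `C`, `γ`, `L`, `up` are read). [cite: Balaban1989LargeFieldII, Thm 1 p.355, (0.1) pp.355–356 («for some E₋, E₊»; bookkeeping)] -/
theorem N24_isRecordOfRecord₁₂CB10YZWB8_withExp (h : IsRecordOfRecord₁₂CB10YZWB8 F N D w) (em ep : ℝ → ℝ) :
    IsRecordOfRecord₁₂CB10YZWB8 F N D { w with em := em, ep := ep } := by
  obtain ⟨θ, hP, lam, Mstar, ops, ζ, lamW, hθ, hD, hC, hγ, hL, hup⟩ := h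
  exact ⟨θ, hP, lam, Mstar, ops, ζ, lamW, hθ, hD, hC, hγ, hL, hup⟩

/-- **N01 N02 N03 N04 ARE THEOREMS at every run of a five-pin Stage-12 record** (node00-def's `b4_b5_b6_b7_of_isRecordOfRecord₁₂CB10YZWB8` — the SAME-DATUM companion's Stage-5
theorems; none of the four sentences reads `b8`). [cite: Balaban1983RegularityDecay, Theorem p.573; Balaban1984PropagatorsI, Props. 1.1–1.2 pp.33–36; Balaban1984PropagatorsII, Lemma 2.1 – Cor. 2.8 pp.223–250; Balaban1985Averaging, Props. 1–10 pp.26–50 (kernel versions of the lineages, transferred)] -/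
theorem N24_nodes₀₁₀₂₀₃₀₄_of_isRecordOfRecord₁₂CB10YZWB8 (h : IsRecordOfRecord₁₂CB10YZWB8 F N D w) (P : B12.RunParams) :
    Dag.B4_main (leavesP w P) ∧ Dag.B5_main (leavesP w P) ∧ Dag.B6_main (leavesP w P) ∧ Dag.B7_main (leavesP w P) := by
  obtain ⟨h4, h5, h6, h7⟩ := b4_b5_b6_b7_of_isRecordOfRecord₁₂CB10YZWB8 h P
  exact ⟨h4, fun _ => h5, fun _ _ => h6, fun _ => h7⟩

/-- **GUARDED (0.20) at the S-bound world**: in-interval couplings ⇒ the RG equations, at every run of a five-pin Stage-12 record (def-T's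
`rgFlow_of_smallCouplings_of_isRecordOfRecord₁₂C` at the C-bound twin world — both leaves read `w.C`, `w.γ` only, `rfl` transport).
[cite: Balaban1987RG1, (0.20) p.256] -/
theorem N24_rgFlow_of_smallCouplings_of_isRecordOfRecord₁₂CB10YZWB8 (h : IsRecordOfRecord₁₂CB10YZWB8 F N D w) (P : B12.RunParams)
    (hsc : (leavesP w P).smallCouplings) : (leavesP w P).rgFlow := by
  obtain ⟨θ, hP, lam, Mstar, ops, ζ, lamW, hθ, hD, hC, hγ, hL, -⟩ := h
  have hw' : IsRecordOfRecord₁₂CB10YZW F N D { w with up := fun P => upOfRecord₅C F N (θ.view₁₂B8B10YZW F N lam Mstar ops ζ lamW) P } :=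
    ⟨θ.pinB8 F N lam, hP.pinB8 lam, Mstar, ops, ζ, lamW, (Stage12Params.pinB8_admissible_iff F N _ _).2 hθ,
      by rw [datumOfRecord₁₂_pinB8]; exact hD, hC, hγ, hL, fun _ => rfl⟩
  exact rgFlow_of_smallCouplings_of_isRecordOfRecord₁₂C (isRecordOfRecord₁₂C_of_isRecordOfRecord₁₂CB10YZW hw') P hsc

/-- **N24 · (B2) AT THE FIVE-PIN STAGE-12 RECORD — THE ENGINE AT THE S-BOUND WORLD**: from the nine by-name binders N05 … N13 at every run of `w` and the β-box
`w.b ≤ D.βfun ≤ w.βup` on `]0, γ₀]^{k+1}`, `γ₀ ≥ w.γ`: `B16.EndStatementBPrinted D.C`.  DagBinding's headline `endStatementBPrinted_of_nodesP_interval_guarded` AT `w` ITSELF (no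
record predicate reads the S-binding): N01–N04 and the guarded (0.20) carried from the companion (`b8`-free sentences), `0 < w.γ` and `w.C = D.C` from the record, the
in-interval β-bounds from the box bounds through the datum's dictionary field `D.curries` (`DagBinding.betaBoundsInInterval_of_boxBounds`).
[cite: Balaban1989LargeFieldII, Thm 1 p.355 + pp.387, 391; Balaban1987RG1, (0.20) p.256, (1.22) p.264 (bookkeeping over the [B8]-pinned Stage-12 record)] -/
theorem N24_at_record₁₂CB10YZWB8 (h : IsRecordOfRecord₁₂CB10YZWB8 F N D w) {γ₀ : ℝ} (hγ₀ : w.γ ≤ γ₀)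
    (h05 : ∀ P : B12.RunParams, Dag.B8_main (leavesP w P)) (h06 : ∀ P : B12.RunParams, Dag.B9_main (leavesP w P))
    (h07 : ∀ P : B12.RunParams, Dag.B11_main (leavesP w P)) (h08 : ∀ P : B12.RunParams, Dag.B10_main (leavesP w P))
    (h09 : ∀ P : B12.RunParams, Dag.B12_main (leavesP w P)) (h10 : ∀ P : B12.RunParams, Dag.B13_main (leavesP w P))
    (h11 : ∀ P : B12.RunParams, Dag.B14_main (leavesP w P)) (h12 : ∀ P : B12.RunParams, Dag.B15_main (leavesP w P))
    (h13 : ∀ P : B12.RunParams, Dag.B16_main (leavesP w P))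
    (hlo : FlowStep.BetaLowerH w.b γ₀ D.βfun) (hhi : FlowStep.BetaUpperH w.βup γ₀ D.βfun) :
    B16.EndStatementBPrinted D.C := by
  have hrg := N24_rgFlow_of_smallCouplings_of_isRecordOfRecord₁₂CB10YZWB8 h
  have hn := N24_nodes₀₁₀₂₀₃₀₄_of_isRecordOfRecord₁₂CB10YZWB8 h
  obtain ⟨θ, hP, lam, Mstar, ops, ζ, lamW, -, -, hC, hγ, -, -⟩ := h
  have hβ : BetaBoundsInInterval w.C.toB12 γ₀ w.b w.βup := by
    rw [hC]
    exact DagBinding.betaBoundsInInterval_of_boxBounds D.C.toB12 D.βfun D.curries hlo hhi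
  rw [← hC]
  exact endStatementBPrinted_of_nodesP_interval_guarded w hγ.1 hγ₀
    (fun P => ⟨(hn P).1, (hn P).2.1, (hn P).2.2.1, (hn P).2.2.2, h05 P, h06 P, h08 P, h07 P, h09 P, h10 P, h11 P, h12 P, h13 P⟩) hrg hβ

/-- **The engine with N13 in its ∃-exponent form** («for SOME dependence letters `(e₋, e₊)`, N13 at every run of `{ w with em := e₋, ep := e₊ }`» — (B2) does not read the
world's exponent letters; every other child is insensitive to them, `rfl`). [cite: Balaban1989LargeFieldII, Thm 1 p.355, (0.1) pp.355–356 («for some E₋, E₊»), p.391] -/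
theorem N24_at_record₁₂CB10YZWB8_of_N13_exists (h : IsRecordOfRecord₁₂CB10YZWB8 F N D w) {γ₀ : ℝ} (hγ₀ : w.γ ≤ γ₀)
    (h05 : ∀ P : B12.RunParams, Dag.B8_main (leavesP w P)) (h06 : ∀ P : B12.RunParams, Dag.B9_main (leavesP w P))
    (h07 : ∀ P : B12.RunParams, Dag.B11_main (leavesP w P)) (h08 : ∀ P : B12.RunParams, Dag.B10_main (leavesP w P))
    (h09 : ∀ P : B12.RunParams, Dag.B12_main (leavesP w P)) (h10 : ∀ P : B12.RunParams, Dag.B13_main (leavesP w P))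
    (h11 : ∀ P : B12.RunParams, Dag.B14_main (leavesP w P)) (h12 : ∀ P : B12.RunParams, Dag.B15_main (leavesP w P))
    (h13 : ∃ em ep : ℝ → ℝ, ∀ P : B12.RunParams, Dag.B16_main (leavesP { w with em := em, ep := ep } P))
    (hlo : FlowStep.BetaLowerH w.b γ₀ D.βfun) (hhi : FlowStep.BetaUpperH w.βup γ₀ D.βfun) :
    B16.EndStatementBPrinted D.C := by
  obtain ⟨em, ep, h13⟩ := h13
  exact N24_at_record₁₂CB10YZWB8 (N24_isRecordOfRecord₁₂CB10YZWB8_withExp h em ep) hγ₀ h05 h06 h07 h08 h09 h10 h11 h12 h13 hlo hhi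

/-- **N06 ∕ N07 ∕ N12 ∕ N08 AT A FIVE-PIN STAGE-12 RECORD FROM THE PINNED LEAVES**: «for every presenting `(θ, h, λ, M⋆, ops, ζ, λW)`: def-Y's leaf `B9LeafX (Y9OfRecord N θ₃ M⋆ ops)` ∧
`B11Leaf (Z11OfRecord F N ζ)` ∧ `∀ P, B15Leaf (WOfRecord₁₂ θ λW P)`» (hidden layers — junk-closable, honest) and the printed slot `PrintedUV3V N L` at the world's odd block size `L > 1`
give `Dag.B9_main ∧ Dag.B11_main ∧ Dag.B15_main ∧ Dag.B10_main` at every run (the five-pin view's leaves `upOfRecord₅CS_view₁₂B8B10YZW_leaves`; the DAG sentences discard their in-edges).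
[cite: Balaban1985BackgroundPropagators, Thms 3.1–3.15 pp.397–432; Balaban1985Variational, Thm 1 p.279; Balaban1989LargeFieldI, Prop. 1 p.194; Balaban1985UV3, (1)–(5) p.256, Thm 1 p.257 + Thm 2 p.272 (the nodes' shapes at the pinned objects; bookkeeping)] -/
theorem N24_b9_b11_b15_b10_main_of_isRecordOfRecord₁₂CB10YZWB8_of_slots (h : IsRecordOfRecord₁₂CB10YZWB8 F N D w)
    (hYZW : ∀ (θ : Stage12Params F N) (hP : θ.Provisos₁₂ F N) (lam : ResidB8 θ.toStage3Params) (Mstar : ℕ) (ops : OpsY N θ.toStage3Params Mstar) (ζ : ResidZ F N)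
      (lamW : ResidW F N), θ.Admissible F N → D = datumOfRecord₁₂ F N θ hP →
        (∀ P, w.up P = upOfRecord₅CS F N (θ.view₁₂B8B10YZW F N lam Mstar ops ζ lamW) P) →
          B9LeafX (Y9OfRecord N θ.toStage3Params Mstar ops) ∧ B11Leaf (Z11OfRecord F N ζ) ∧ ∀ P : B12.RunParams, B15Leaf (WOfRecord₁₂ F N θ lamW P))
    (hUV₀₈ : ∀ L : ℕ, Odd L → 1 < L → w.L = (L : ℝ) → PrintedUV3V N L) (P : B12.RunParams) :
    Dag.B9_main (leavesP w P) ∧ Dag.B11_main (leavesP w P) ∧ Dag.B15_main (leavesP w P) ∧ Dag.B10_main (leavesP w P) := by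
  obtain ⟨θ, hP, lam, Mstar, ops, ζ, lamW, hθ, hD, -, -, hL, hup⟩ := h
  have hl := upOfRecord₅CS_view₁₂B8B10YZW_leaves F N θ lam Mstar ops ζ lamW P
  obtain ⟨h9, h11, h15⟩ := hYZW θ hP lam Mstar ops ζ lamW hθ hD hup
  refine ⟨fun _ _ _ _ => ?_, fun _ _ _ _ _ => ?_, fun _ _ _ _ _ => ?_, fun _ _ _ _ _ _ => ?_⟩
  · show (w.up P).b9
    rw [hup P]; exact hl.2.2.1.2 h9
  · show (w.up P).b11
    rw [hup P]; exact hl.2.2.2.2.2 h11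
  · show (w.up P).rBasicStep
    rw [hup P]; exact hl.2.1.2 (h15 P)
  · show (w.up P).b10
    rw [hup P]; exact hl.2.2.2.1.2 (hUV₀₈ θ.L θ.hL.1 θ.hL.2 hL)

/-- **N10 · [Balaban1988RG2Cluster] AT A FIVE-PIN STAGE-12 RECORD FROM THE B13 SOCKET OVER THE FIVE-PIN VIEW** (`B13NodeKnitRecord5C.b13_main_at_stage5ParamsC` at the C-bound twin
world `{ w with up := C-binding at the five-pin view }`; `Dag.B13_main` reads `b9 b10 b11 b12 b13` only, and the S-binding re-binds `b8` alone, so the sentence transports by `rfl`).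
The socket's residual groups: the [B10] runs, Y, Z are the PINNED ones of the view; B12 ∕ B13 residual. [cite: Balaban1988RG2Cluster, Lemmas 1–3 pp.9, 11, 20 (the node's shape at the Stage-12 five-pin view; bookkeeping)] -/
theorem N24_b13_main_of_isRecordOfRecord₁₂CB10YZWB8_of_slot (h : IsRecordOfRecord₁₂CB10YZWB8 F N D w)
    (slots₁₀ : ∀ (θ : Stage12Params F N) (hP : θ.Provisos₁₂ F N) (lam : ResidB8 θ.toStage3Params) (Mstar : ℕ) (ops : OpsY N θ.toStage3Params Mstar) (ζ : ResidZ F N)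
      (lamW : ResidW F N), θ.Admissible F N → D = datumOfRecord₁₂ F N θ hP →
        (∀ P, w.up P = upOfRecord₅CS F N (θ.view₁₂B8B10YZW F N lam Mstar ops ζ lamW) P) → ∀ P : B12.RunParams,
          B9LeafX ((θ.view₁₂B8B10YZW F N lam Mstar ops ζ lamW).res.Y P) →
            (B10.Thm1PrintedCompact ((θ.view₁₂B8B10YZW F N lam Mstar ops ζ lamW).res.X P).runs10 ∧
                B10.Thm2Printed ((θ.view₁₂B8B10YZW F N lam Mstar ops ζ lamW).res.X P).runs10) →
              B11Leaf ((θ.view₁₂B8B10YZW F N lam Mstar ops ζ lamW).res.Z P) →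
                B12Sec2to5.Lemma4Printed ((θ.view₁₂B8B10YZW F N lam Mstar ops ζ lamW).res.X P).F12
                    ((θ.view₁₂B8B10YZW F N lam Mstar ops ζ lamW).res.X P).c12 →
                  B13.Lemma1Printed ((θ.view₁₂B8B10YZW F N lam Mstar ops ζ lamW).res.X P).S13 ((θ.view₁₂B8B10YZW F N lam Mstar ops ζ lamW).res.X P).c13 ∧
                    B13.Lemma2Printed ((θ.view₁₂B8B10YZW F N lam Mstar ops ζ lamW).res.X P).S13 ((θ.view₁₂B8B10YZW F N lam Mstar ops ζ lamW).res.X P).c13 ∧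
                      B13.Lemma3Printed ((θ.view₁₂B8B10YZW F N lam Mstar ops ζ lamW).res.X P).S13 ((θ.view₁₂B8B10YZW F N lam Mstar ops ζ lamW).res.X P).c13)
    (P : B12.RunParams) : Dag.B13_main (leavesP w P) := by
  obtain ⟨θ, hP, lam, Mstar, ops, ζ, lamW, hθ, hD, -, -, -, hup⟩ := h
  have h' : Dag.B13_main (leavesP { w with up := fun P => upOfRecord₅C F N (θ.view₁₂B8B10YZW F N lam Mstar ops ζ lamW) P } P) :=
    B13NodeKnitRecord5C.b13_main_at_stage5ParamsC F N (θ.view₁₂B8B10YZW F N lam Mstar ops ζ lamW) _ P rfl (slots₁₀ θ hP lam Mstar ops ζ lamW hθ hD hup P)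
  show (w.up P).b9 → (w.up P).b10 → (w.up P).b11 → (w.up P).b12 → (w.up P).b13
  rw [hup P]
  exact h'

/-- **N13 · [Balaban1989LargeFieldII] WORLD-LEVEL AT A FIVE-PIN STAGE-12 RECORD**: from the record's 𝐑-leaf `hR : ∀ P, (w.up P).rOperation` (= «𝐓-image form ⇒ §2 form one level up»
along the tower of record, format pinned) and «∃ (e₋, e₊) R, the five [Balaban1988Convergent] Cor.-3 leaves at `(D.C, w.γ)`»: N13 at every run of `{ w with em := e₋, ep := e₊ }` for
SOME `(e₋, e₊)` — seat dag-n13-a's `B16NodeKnitRecordPinned.b16_main_of_isRecordOfRecord₅C_of_leaf` at the SHADOW of the C-bound twin world (module 15's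
`N24_b16_main_withExp_of_cor3Leaves₅C`, `D₅.C = D.C` consumed), transported back by `rfl` (`Dag.B16_main` reads no `b8`). [cite: Balaban1989LargeFieldII, Thm 1 p.355, p.387, p.391; Balaban1988Convergent, p.244, Thm 2 p.263, Cor. 3 (2.50) p.264 (node bookkeeping at the [B8]-pinned record)] -/
theorem N24_b16_main_withExp_of_isRecordOfRecord₁₂CB10YZWB8 (h : IsRecordOfRecord₁₂CB10YZWB8 F N D w) (hR : ∀ P : B12.RunParams, (w.up P).rOperation)
    (hcor3 : ∃ (em ep : ℝ → ℝ) (R : B14Cor3.ReprFamily D.C),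
      B14Cor3.LeafH D.C R w.γ ∧ B14Cor3.LeafU1 D.C R w.γ ∧ B14Cor3.LeafU2 D.C R w.γ ep ∧ B14Cor3.LeafL1 D.C R w.γ ∧ B14Cor3.LeafL2 D.C R w.γ em) :
    ∃ em ep : ℝ → ℝ, ∀ P : B12.RunParams, Dag.B16_main (leavesP { w with em := em, ep := ep } P) := by
  obtain ⟨θ, hP, lam, Mstar, ops, ζ, lamW, hθ, hD, hC, hγ, hL, hup⟩ := h
  have hw' : IsRecordOfRecord₁₂CB10YZW F N D { w with up := fun P => upOfRecord₅C F N (θ.view₁₂B8B10YZW F N lam Mstar ops ζ lamW) P } :=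
    ⟨θ.pinB8 F N lam, hP.pinB8 lam, Mstar, ops, ζ, lamW, (Stage12Params.pinB8_admissible_iff F N _ _).2 hθ,
      by rw [datumOfRecord₁₂_pinB8]; exact hD, hC, hγ, hL, fun _ => rfl⟩
  obtain ⟨D₅, h₅, hC5, -⟩ := exists_isRecordOfRecord₅C_of_isRecordOfRecord₁₂C (isRecordOfRecord₁₂C_of_isRecordOfRecord₁₂CB10YZW hw')
  have hR' : ∀ P : B12.RunParams,
      (({ w with up := fun P => upOfRecord₅C F N (θ.view₁₂B8B10YZW F N lam Mstar ops ζ lamW) P } : WorldP).up P).rOperation := fun P => by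
    have hRP := hR P
    rw [hup P] at hRP
    exact hRP
  rw [← hC5] at hcor3
  obtain ⟨em, ep, R, hH, hU1, hU2, hL1, hL2⟩ := hcor3
  refine ⟨em, ep, fun P => ?_⟩
  have h16 := N24_b16_main_withExp_of_cor3Leaves₅C h₅ hR' em ep R hH hU1 hU2 hL1 hL2 P
  show (w.up P).b5 → (w.up P).b6 → (w.up P).b7 → (w.up P).b9 → (w.up P).b10 → (w.up P).b11 → (w.up P).b13 → (w.up P).rBasicStep → _ →
    ((w.up P).rOperation ∧ _)
  rw [hup P]
  exact h16

/-- **N24 · (B2) AT THE FIVE-PIN STAGE-12 RECORD, THE PINNED CHILDREN AT THEIR STATEMENTS OF RECORD, EVERY OTHER CHILD BY NAME** (module 17's recipe at Stage 12 over node00-def's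
`Record12CarriersRecords`; FAN-OUT v1.1 §N24 s2): **N05** ← «for every presenting `(θ, h, λ, M⋆, ops, ζ, λW)`: the SURVIVING [Balaban1985RegularSpaces] leaf AT THE GROUP OF RECORD
`B8LeafOfRecord θ.toStage3Params λ`» (node00-def's `b8_main_of_isRecordOfRecord₁₂CB10YZWB8_of_slots`; DISPLAYED, ref-C (B8-2)∕(B8-3) — n05-a's discharge-shaped sentence `CarriersB8.b8LeafOfRecord_of_knit`
is its closer by name, modulo the five sockets + the residual-reading members; junk-closable over the residual `λ`, hence location-positive ∕ strength-neutral); **N06 ∧ N07 ∧ N12** ← the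
hidden layers' leaves `hYZW`; **N08** ← the printed slot `PrintedUV3V N L` at the world's odd `L > 1`; **N10** ← the B13 socket over the five-pin view's residual groups; **N09, N11** by-name
binders at `w` (their Stage-12 faces port through node00-def's `nodes_iff_bundles_of_…` with `b8` displayed — (B8-2) —, pending); **N13** world-level `hR` + `hcor3`; β-box on `D.βfun`.  WHICH
CHILD BLOCKS at `₁₂CB10YZWB8`, kernel form: N05 the surviving-leaf slot; N06 ∧ N07 ∧ N12 hidden-layer leaves; N08 one printed ∃-slot; N10 one residual socket; N09 ×1; N11 ×1; N13
𝐑-leaf + Cor.-3; β ×2; K0 at ₁₂. [cite: Balaban1989LargeFieldII, Thm 1 p.355, (0.1) pp.355–356, p.387, p.391; Balaban1985RegularSpaces, Lemma 1 – Thm 8 pp.79–101, Thm 8 p.101 (surviving form); Balaban1985UV3, (1)–(5) p.256, Thm 1 p.257 + Thm 2 p.272; Balaban1985BackgroundPropagators, Thms 3.1–3.15 pp.397–432; Balaban1985Variational, Thm 1 p.279, Props 2–9 pp.281–309; Balaban1988Convergent, Thm 1 p.262, Thm 2 p.263, p.244, Cor. 3 (2.50) p.264; Balaban1987RG1, Thm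 3 p.264, (0.20) p.256, (1.22) p.264; Balaban1988RG2Cluster, Lemmas 1–3 pp.9, 11, 20; Balaban1989LargeFieldI, Prop. 1 p.194 (bookkeeping over the [B8]-pinned Stage-12 record)] -/
theorem N24_at_record₁₂CB10YZWB8_knit_all_carriers_pinned (h : IsRecordOfRecord₁₂CB10YZWB8 F N D w) {γ₀ : ℝ} (hγ₀ : w.γ ≤ γ₀)
    (hB8 : ∀ (θ : Stage12Params F N) (hP : θ.Provisos₁₂ F N) (lam : ResidB8 θ.toStage3Params) (Mstar : ℕ) (ops : OpsY N θ.toStage3Params Mstar) (ζ : ResidZ F N)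
      (lamW : ResidW F N), θ.Admissible F N → D = datumOfRecord₁₂ F N θ hP →
        (∀ P, w.up P = upOfRecord₅CS F N (θ.view₁₂B8B10YZW F N lam Mstar ops ζ lamW) P) → B8LeafOfRecord θ.toStage3Params lam)
    (hYZW : ∀ (θ : Stage12Params F N) (hP : θ.Provisos₁₂ F N) (lam : ResidB8 θ.toStage3Params) (Mstar : ℕ) (ops : OpsY N θ.toStage3Params Mstar) (ζ : ResidZ F N)
      (lamW : ResidW F N), θ.Admissible F N → D = datumOfRecord₁₂ F N θ hP →
        (∀ P, w.up P = upOfRecord₅CS F N (θ.view₁₂B8B10YZW F N lam Mstar ops ζ lamW) P) →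
          B9LeafX (Y9OfRecord N θ.toStage3Params Mstar ops) ∧ B11Leaf (Z11OfRecord F N ζ) ∧ ∀ P : B12.RunParams, B15Leaf (WOfRecord₁₂ F N θ lamW P))
    (hUV₀₈ : ∀ L : ℕ, Odd L → 1 < L → w.L = (L : ℝ) → PrintedUV3V N L)
    (h09 : ∀ P : B12.RunParams, Dag.B12_main (leavesP w P))
    (slots₁₀ : ∀ (θ : Stage12Params F N) (hP : θ.Provisos₁₂ F N) (lam : ResidB8 θ.toStage3Params) (Mstar : ℕ) (ops : OpsY N θ.toStage3Params Mstar) (ζ : ResidZ F N)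
      (lamW : ResidW F N), θ.Admissible F N → D = datumOfRecord₁₂ F N θ hP →
        (∀ P, w.up P = upOfRecord₅CS F N (θ.view₁₂B8B10YZW F N lam Mstar ops ζ lamW) P) → ∀ P : B12.RunParams,
          B9LeafX ((θ.view₁₂B8B10YZW F N lam Mstar ops ζ lamW).res.Y P) →
            (B10.Thm1PrintedCompact ((θ.view₁₂B8B10YZW F N lam Mstar ops ζ lamW).res.X P).runs10 ∧
                B10.Thm2Printed ((θ.view₁₂B8B10YZW F N lam Mstar ops ζ lamW).res.X P).runs10) →
              B11Leaf ((θ.view₁₂B8B10YZW F N lam Mstar ops ζ lamW).res.Z P) →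
                B12Sec2to5.Lemma4Printed ((θ.view₁₂B8B10YZW F N lam Mstar ops ζ lamW).res.X P).F12
                    ((θ.view₁₂B8B10YZW F N lam Mstar ops ζ lamW).res.X P).c12 →
                  B13.Lemma1Printed ((θ.view₁₂B8B10YZW F N lam Mstar ops ζ lamW).res.X P).S13 ((θ.view₁₂B8B10YZW F N lam Mstar ops ζ lamW).res.X P).c13 ∧
                    B13.Lemma2Printed ((θ.view₁₂B8B10YZW F N lam Mstar ops ζ lamW).res.X P).S13 ((θ.view₁₂B8B10YZW F N lam Mstar ops ζ lamW).res.X P).c13 ∧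
                      B13.Lemma3Printed ((θ.view₁₂B8B10YZW F N lam Mstar ops ζ lamW).res.X P).S13 ((θ.view₁₂B8B10YZW F N lam Mstar ops ζ lamW).res.X P).c13)
    (h11 : ∀ P : B12.RunParams, Dag.B14_main (leavesP w P))
    (hR : ∀ P : B12.RunParams, (w.up P).rOperation)
    (hcor3 : ∃ (em ep : ℝ → ℝ) (R : B14Cor3.ReprFamily D.C),
      B14Cor3.LeafH D.C R w.γ ∧ B14Cor3.LeafU1 D.C R w.γ ∧ B14Cor3.LeafU2 D.C R w.γ ep ∧ B14Cor3.LeafL1 D.C R w.γ ∧ B14Cor3.LeafL2 D.C R w.γ em)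
    (hlo : FlowStep.BetaLowerH w.b γ₀ D.βfun) (hhi : FlowStep.BetaUpperH w.βup γ₀ D.βfun) :
    B16.EndStatementBPrinted D.C :=
  have h4 := N24_b9_b11_b15_b10_main_of_isRecordOfRecord₁₂CB10YZWB8_of_slots h hYZW hUV₀₈
  N24_at_record₁₂CB10YZWB8_of_N13_exists h hγ₀ (b8_main_of_isRecordOfRecord₁₂CB10YZWB8_of_slots h hB8) (fun P => (h4 P).1) (fun P => (h4 P).2.1)
    (fun P => (h4 P).2.2.2) h09 (N24_b13_main_of_isRecordOfRecord₁₂CB10YZWB8_of_slot h slots₁₀) h11 (fun P => (h4 P).2.2.1)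
    (N24_b16_main_withExp_of_isRecordOfRecord₁₂CB10YZWB8 h hR hcor3) hlo hhi

/-- **The same with the β-binders READ AT THE MERGED β over `mergedTermFamilyMatT (TcOfRecord) (chiFixed7 θ.ν)` along the world's own box `]0, w.γ]^{k+1}`**, keyed on the
five-pin presentations (module 20's iffs at `(θ, h)`: the five-pin record's datum IS `datumOfRecord₁₂ θ h`).  WHICH CHILD BLOCKS at `₁₂CB10YZWB8` in the β-version currency.
[cite: Balaban1989LargeFieldII, Thm 1 p.355, (0.1) pp.355–356, p.391; Balaban1987RG1, (0.19) p.255, (1.20)–(1.22) p.264, (2.12)–(2.14) p.268; Balaban1985RegularSpaces, Thm 8 p.101; Balaban1985UV3, Thm 1 p.257 + Thm 2 p.272; Balaban1985BackgroundPropagators, Thms 3.1–3.15 pp.397–432; Balaban1985Variational, Thm 1 p.279; Balaban1989LargeFieldI, Prop. 1 p.194 (bookkeeping)] -/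
theorem N24_at_record₁₂CB10YZWB8_knit_all_carriers_of_betaMerged_pinned (h : IsRecordOfRecord₁₂CB10YZWB8 F N D w)
    (hB8 : ∀ (θ : Stage12Params F N) (hP : θ.Provisos₁₂ F N) (lam : ResidB8 θ.toStage3Params) (Mstar : ℕ) (ops : OpsY N θ.toStage3Params Mstar) (ζ : ResidZ F N)
      (lamW : ResidW F N), θ.Admissible F N → D = datumOfRecord₁₂ F N θ hP →
        (∀ P, w.up P = upOfRecord₅CS F N (θ.view₁₂B8B10YZW F N lam Mstar ops ζ lamW) P) → B8LeafOfRecord θ.toStage3Params lam)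
    (hYZW : ∀ (θ : Stage12Params F N) (hP : θ.Provisos₁₂ F N) (lam : ResidB8 θ.toStage3Params) (Mstar : ℕ) (ops : OpsY N θ.toStage3Params Mstar) (ζ : ResidZ F N)
      (lamW : ResidW F N), θ.Admissible F N → D = datumOfRecord₁₂ F N θ hP →
        (∀ P, w.up P = upOfRecord₅CS F N (θ.view₁₂B8B10YZW F N lam Mstar ops ζ lamW) P) →
          B9LeafX (Y9OfRecord N θ.toStage3Params Mstar ops) ∧ B11Leaf (Z11OfRecord F N ζ) ∧ ∀ P : B12.RunParams, B15Leaf (WOfRecord₁₂ F N θ lamW P))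
    (hUV₀₈ : ∀ L : ℕ, Odd L → 1 < L → w.L = (L : ℝ) → PrintedUV3V N L)
    (h09 : ∀ P : B12.RunParams, Dag.B12_main (leavesP w P))
    (slots₁₀ : ∀ (θ : Stage12Params F N) (hP : θ.Provisos₁₂ F N) (lam : ResidB8 θ.toStage3Params) (Mstar : ℕ) (ops : OpsY N θ.toStage3Params Mstar) (ζ : ResidZ F N)
      (lamW : ResidW F N), θ.Admissible F N → D = datumOfRecord₁₂ F N θ hP →
        (∀ P, w.up P = upOfRecord₅CS F N (θ.view₁₂B8B10YZW F N lam Mstar ops ζ lamW) P) → ∀ P : B12.RunParams,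
          B9LeafX ((θ.view₁₂B8B10YZW F N lam Mstar ops ζ lamW).res.Y P) →
            (B10.Thm1PrintedCompact ((θ.view₁₂B8B10YZW F N lam Mstar ops ζ lamW).res.X P).runs10 ∧
                B10.Thm2Printed ((θ.view₁₂B8B10YZW F N lam Mstar ops ζ lamW).res.X P).runs10) →
              B11Leaf ((θ.view₁₂B8B10YZW F N lam Mstar ops ζ lamW).res.Z P) →
                B12Sec2to5.Lemma4Printed ((θ.view₁₂B8B10YZW F N lam Mstar ops ζ lamW).res.X P).F12
                    ((θ.view₁₂B8B10YZW F N lam Mstar ops ζ lamW).res.X P).c12 →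
                  B13.Lemma1Printed ((θ.view₁₂B8B10YZW F N lam Mstar ops ζ lamW).res.X P).S13 ((θ.view₁₂B8B10YZW F N lam Mstar ops ζ lamW).res.X P).c13 ∧
                    B13.Lemma2Printed ((θ.view₁₂B8B10YZW F N lam Mstar ops ζ lamW).res.X P).S13 ((θ.view₁₂B8B10YZW F N lam Mstar ops ζ lamW).res.X P).c13 ∧
                      B13.Lemma3Printed ((θ.view₁₂B8B10YZW F N lam Mstar ops ζ lamW).res.X P).S13 ((θ.view₁₂B8B10YZW F N lam Mstar ops ζ lamW).res.X P).c13)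
    (h11 : ∀ P : B12.RunParams, Dag.B14_main (leavesP w P))
    (hR : ∀ P : B12.RunParams, (w.up P).rOperation)
    (hcor3 : ∃ (em ep : ℝ → ℝ) (R : B14Cor3.ReprFamily D.C),
      B14Cor3.LeafH D.C R w.γ ∧ B14Cor3.LeafU1 D.C R w.γ ∧ B14Cor3.LeafU2 D.C R w.γ ep ∧ B14Cor3.LeafL1 D.C R w.γ ∧ B14Cor3.LeafL2 D.C R w.γ em)
    (hβm : ∀ (θ : Stage12Params F N) (hP : θ.Provisos₁₂ F N) (lam : ResidB8 θ.toStage3Params) (Mstar : ℕ) (ops : OpsY N θ.toStage3Params Mstar) (ζ : ResidZ F N)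
      (lamW : ResidW F N), θ.Admissible F N → D = datumOfRecord₁₂ F N θ hP → w.γ ≤ θ.γ →
        (∀ P, w.up P = upOfRecord₅CS F N (θ.view₁₂B8B10YZW F N lam Mstar ops ζ lamW) P) →
      letI := θ.instVβ₁; letI := θ.instVβ₂; letI := θ.instιβ
      FlowStep.BetaLowerH w.b w.γ (betaMerged F (mergedTermFamilyMatT F N (TcOfRecord F N) (chiFixed7 F N θ.ν) θ.εbg) θ.ρ8 θ.bV) ∧
        FlowStep.BetaUpperH w.βup w.γ (betaMerged F (mergedTermFamilyMatT F N (TcOfRecord F N) (chiFixed7 F N θ.ν) θ.εbg) θ.ρ8 θ.bV)) :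
    B16.EndStatementBPrinted D.C := by
  obtain ⟨θ, hP, lam, Mstar, ops, ζ, lamW, hθ, hD, -, hγ, -, hup⟩ := id h
  obtain ⟨hlo, hhi⟩ := hβm θ hP lam Mstar ops ζ lamW hθ hD hγ.2 hup
  exact N24_at_record₁₂CB10YZWB8_knit_all_carriers_pinned h le_rfl hB8 hYZW hUV₀₈ h09 slots₁₀ h11 hR hcor3
    ((N24_betaLowerH_iff_merged₁₂ θ hP hD hγ.2).mpr hlo) ((N24_betaUpperH_iff_merged₁₂ θ hP hD hγ.2).mpr hhi)

end Literature.MathematicalPhysics.QuantumFieldTheory.Balaban1983to89.Node00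

end
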